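import Literature.NumberTheory.DiophantineGeometry.MordellCoprimeGreatestPrimeFactorExplicitProofs
import Literature.NumberTheory.DiophantineGeometry.MordellPrimitiveAsymptoticHeightBoundProofs
import Literature.NumberTheory.DiophantineGeometry.SumsOfUnitsCorollaryLProofs
import Literature.NumberTheory.DiophantineGeometry.SUnitMordellFirstModularityBoundsProofs
import Literature.NumberTheory.DiophantineGeometry.AbcAsymptoticHeightBoundProofs
import Literature.NumberTheory.EllipticCurves.HeightConductorBounds2014Proofs
import Literature.NumberTheory.EllipticCurves.HeightConductorBoundsPropTenEightAsymptoticProofs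
import Literature.NumberTheory.DiophantineGeometry.SumsOfUnitsOptimizedProofs
import Literature.NumberTheory.DiophantineGeometry.MordellSimplifiedHeightBoundProofs
import Literature.NumberTheory.EllipticCurves.SUnitFreyHellegouarchLemmaTenFiveProofs
import Literature.NumberTheory.EllipticCurves.IsogenyConductorModularityProofs
import HarnessLib

/-!
# von Känel–Matschke / von Känel 2014 / Murty–Pasten: the typed height bounds as theorems from the §10 roots
# (summary, proofs only)

Topic `Literature/NumberTheory/DiophantineGeometry` (family `abc`). An INDEX file (theorems only; NO definition, NO
new named fact; D-0014, D-0026): it assembles, as three conjunctions, the derivations landed across the tree showing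
that the typed statements of R. von Känel, B. Matschke, arXiv:1605.06079 = Mem. AMS 286 (2023) [`VonkanelMatschke2023`],
of R. von Känel, Trans. AMS 366 (2014) [`VonKanelModuli2014`] and of Murty–Pasten 2013 [`MurtyPasten2013`] hang off
the following ROOT named facts of `Literature.NumberTheory.EllipticCurves.ModularForms`:

* `hmod = nonempty_modularParametrizationData` (modularity: a parametrisation `X₀(N_E) → E` with the printed
  normalisations),
* `hi = vonKanelMatschke_prop_10_8_i` (the Faltings-height bound `h(E) ≤ …` of Prop. 10.8 (i)),
* `h103 = vonKanelMatschke_lemma_10_3`, `h104 = vonKanelMatschke_lemma_10_4` (the Mordell curves of §10.3),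
* `h105 = vonKanelMatschke_lemma_10_5` (the Frey–Hellegouarch curves of §10.4) together with the Ogg–Saito schema
  `hOS : ∀ W ℓ, W.artinConductorExponent_tate_eq_conductorExponent_of_isElliptic ℓ`,

everything else in the chain (Prop. 10.8 (ii), (iii), (eq:nuineq), (eq:szpiro), Prop. 10.1, the reductions of
Def. 7.1, the conductor–reduction dictionary, the prime number theorem) being theorems of the tree.

* `mordell_family_of_roots` — from `{hmod, h103, h104, hi}`: Prop. 10.1 (`mordell_height_le`), Thm. 7.2 (i), (ii),
  Thm. G, Cor. H, Cor. 7.3, Cor. 7.4, Cor. 9.1 (with `Ω_opt` and with `Ω_sim`), Cor. 9.3 (sim), Cor. L, and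
  von Känel 2014 Cor. 7.5 (both forms).
* `sUnit_family_of_roots` — from `{hmod, hOS, h105, h103, hi}`: Prop. 10.7, Prop. 10.6, (eq:asymptoticsu),
  von Känel 2014 Cor. 7.2, Murty–Pasten Thm. 1.1 / Cor. / Thm. 1.2 shapes.
* `curve_family_of_roots` — from `{hmod, hi}`: von Känel 2014 Prop. 6.1 and Cor. 6.2, (eq:szpiro) and its
  asymptotic form.
* `mordell_family_of_roots_optimized` — from `{hmod, h103, hi}`: Cor. 9.3 with the printed `Ω_opt` bound
  (`corollary_9_3`) and the simplified display (eq:simplemordell).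
* (2026-08-27, after the discharge `vonKanelMatschke_lemma_10_5_holds` of `SUnitFreyHellegouarchLemmaTenFiveProofs`)
  `abc_family_of_modularity` — from `{hmod, hOS, hi}` alone (`h105` is now a theorem): Prop. 10.6,
  (eq:asymptoticsu), von Känel 2014 Cor. 7.2, Murty–Pasten Thm. 1.1 / Thm. 1.2 shapes; and
  `sUnit_family_of_roots'` — from `{hmod, hOS, h103, hi}`: the same with Prop. 10.7.
* (2026-08-27, later) **the Ogg–Saito schema `hOS` leaves the chain**: the only use of `hOS` was the isogeny
  invariance `N_{E'} = N_E` of the conductor, which modularity itself supplies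
  (`conductorNorm_eq_of_isIsogenous_of_modularity`, file `IsogenyConductorModularityProofs`: the newform attached
  to `E` has level `N_E` by `IsNewformOf.level_eq_level`, and isogenous curves share it). Hence
  `abc_family_of_modularity_of_prop_10_8_i` — from **`{hmod, hi}`**: Prop. 10.6, Prop. 10.2 (both displays,
  `N_S ≥ 53`; the refined display for all `S`), (eq:asymptoticsu), von Känel 2014 Cor. 7.2, Murty–Pasten
  Thm. 1.1 / 1.2 and the asymptotic shapes; `sUnit_family_of_modularity_of_lemma_10_3` — from `{hmod, h103, hi}`:
  the same with Prop. 10.7; `vonKanelMatschke_families_of_three_roots` — everything above from `{hmod, hi, h103, h104}`.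

Not derived (still independent named facts, recorded for planners): `corollaryK` (the printed `2a_S`; only the
`2a_S log a_S` form `corollaryK_log_of_roots` follows), `corollaryJ` / Cor. 8.2 (need Prop. 8.1, arithmetic
Nullstellensatz), `corollaryI` needs in addition Rosser–Schoenfeld Thm. 12 (`corollaryI_of_roots`, hypothesis
`hRS`), `sUnitEquation_height_le` (Prop. 10.2) only for `N_S ≥ 53`
(`sUnitEquation_height_le_of_le_of_modularity_of_prop_10_8_i`), and the counting statements of von Känel 2014
(Cor. 6.3, Prop. 6.4, Cor. 7.3, Cor. 7.6). [cite: VonkanelMatschke2023, §10 (structure of the proofs)]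
-/

noncomputable section

open Literature.NumberTheory.EllipticCurves.ModularForms

namespace Literature.NumberTheory.DiophantineGeometry

namespace VonKanelMatschke

/-- **The Mordell family from `{hmod, h103, h104, hi}`**: Prop. 10.1, Thm. 7.2 (i)+(ii), Thm. G, Cor. H, Cor. 7.3,
Cor. 7.4, Cor. 9.1 (`Ω_opt` and `Ω_sim`), Cor. 9.3 (sim), Cor. L, vK 2014 Cor. 7.5 (log and power forms).
[cite: VonkanelMatschke2023, §10.3 (proofs of Prop. 10.1 and Thm. 7.2), §7.1, §9] -/
theorem mordell_family_of_roots (hmod : nonempty_modularParametrizationData)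
    (h103 : vonKanelMatschke_lemma_10_3) (h104 : vonKanelMatschke_lemma_10_4)
    (hi : vonKanelMatschke_prop_10_8_i) :
    mordell_height_le ∧ theorem_7_2_i ∧ theorem_7_2_ii ∧ theoremG ∧ corollaryH ∧ corollary_7_3 ∧
      corollary_7_4 ∧ corollary_9_1 ∧ corollary_9_1_sim ∧ corollary_9_3_sim ∧ corollary_L ∧
      vonKanel2014_mordell_height_le ∧ vonKanel2014_mordell_height_le_rpow := by
  have h72 := theorem_7_2_i_of_roots hmod h103 h104 hi
  exact ⟨mordell_height_le_of_lemma_10_3_of_prop_10_8_i hmod h103 hi, h72,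
    theorem_7_2_ii_of_roots hmod h104 hi, theoremG_of_theorem_7_2_i h72, corollaryH_of_theorem_7_2_i h72,
    corollary_7_3_of_roots hmod h104 hi, corollary_7_4_of_roots hmod h104 hi,
    corollary_9_1_of_roots hmod h103 hi, corollary_9_1_sim_of_roots hmod h103 hi,
    corollary_9_3_sim_of_roots hmod h103 hi, corollary_L_of_roots hmod h103 hi,
    vonKanel2014_mordell_height_le_of_roots hmod h103 hi, vonKanel2014_mordell_height_le_rpow_of_roots hmod h103 hi⟩

/-- **The `S`-unit / `abc` family from `{hmod, hOS, h105, h103, hi}`**: Prop. 10.7 (both halves), Prop. 10.6,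
(eq:asymptoticsu), vK 2014 Cor. 7.2, Murty–Pasten Thm. 1.1 and its `abc` form, and the asymptotic shapes.
[cite: VonkanelMatschke2023, §10.4–§10.5 (proofs of Prop. 10.2, 10.6, 10.7)] -/
theorem sUnit_family_of_roots (hmod : nonempty_modularParametrizationData)
    (hOS : ∀ (W : WeierstrassCurve ℚ) (ℓ : ℕ) [Fact ℓ.Prime],
      W.artinConductorExponent_tate_eq_conductorExponent_of_isElliptic ℓ)
    (h105 : vonKanelMatschke_lemma_10_5) (h103 : vonKanelMatschke_lemma_10_3)
    (hi : vonKanelMatschke_prop_10_8_i) :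
    proposition_10_7 ∧ abc_log_max_le_refined ∧ eq_asymptoticsu ∧ vonKanel2014_sUnit_height_le ∧
      MurtyPasten.sUnit_height_lt ∧ MurtyPasten.abc_log_max_lt ∧ MurtyPasten.sUnit_height_asymptotic ∧
      MurtyPasten.abc_log_max_asymptotic :=
  ⟨proposition_10_7_of_roots hmod hOS h105 h103 hi,
    abc_log_max_le_refined_of_modularity_of_prop_10_8_i hmod hOS h105 hi,
    eq_asymptoticsu_of_roots hmod hOS h105 hi, vonKanel2014_sUnit_height_le_of_roots hmod hOS h105 hi,
    MurtyPasten.sUnit_height_lt_of_roots hmod hOS h105 hi, MurtyPasten.abc_log_max_lt_of_roots hmod hOS h105 hi,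
    MurtyPasten.sUnit_height_asymptotic_of_roots hmod hOS h105 hi,
    MurtyPasten.abc_log_max_asymptotic_of_roots hmod hOS h105 hi⟩

/-- **The curve family from `{hmod, hi}`**: vK 2014 Prop. 6.1 (`h(E) ≤ …`) and Cor. 6.2 (`log Δ ≤ …`), and vKM's
(eq:szpiro) with its asymptotic form. [cite: VonkanelMatschke2023, §10.5 (Prop. 10.8 and (eq:szpiro))] -/
theorem curve_family_of_roots (hmod : nonempty_modularParametrizationData)
    (hi : vonKanelMatschke_prop_10_8_i) :
    vonKanel2014_height_le ∧ vonKanel2014_log_minimalDiscriminant_le ∧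
      vonKanelMatschke_log_minimalDiscriminant_le ∧ vonKanelMatschke_log_minimalDiscriminant_le_asymptotic :=
  ⟨vonKanel2014_height_le_of_prop_10_8_i hmod hi, vonKanel2014_log_minimalDiscriminant_le_of_prop_10_8_i hmod hi,
    log_minimalDiscriminant_le_of_prop_10_8_i hmod hi, log_minimalDiscriminant_le_asymptotic_of_prop_10_8_i hmod hi⟩

/-- **Addendum to the Mordell family, from `{hmod, h103, hi}`**: Cor. 9.3 with the printed optimized bound
`Ω = 3Ω_opt(1, S) + 9 log N_S` (`corollary_9_3`) and the simplified display (eq:simplemordell)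
`max(h(x), h(y)) ≤ ½h(a) + a_S log a_S`. [cite: VonkanelMatschke2023, Cor. 9.3 (§9) and §10.1.1 (eq:simplemordell)] -/
theorem mordell_family_of_roots_optimized (hmod : nonempty_modularParametrizationData)
    (h103 : vonKanelMatschke_lemma_10_3) (hi : vonKanelMatschke_prop_10_8_i) :
    corollary_9_3 ∧
      ∀ (S : Finset ℕ), (∀ p ∈ S, p.Prime) → ∀ a : ℚ, a ≠ 0 → IsSInteger S a →
        ∀ x y : ℚ, IsSInteger S x → IsSInteger S y → y ^ 2 = x ^ 3 + a →
          max (Height.logHeight₁ x) (Height.logHeight₁ y) ≤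
            1 / 2 * Height.logHeight₁ a + (mordellLevel S a : ℝ) * Real.log (mordellLevel S a) :=
  ⟨corollary_9_3_of_roots hmod h103 hi, eq_simplemordell_of_roots hmod h103 hi⟩

/-- **The `abc` family from `{hmod, hOS, hi}`** — modularity, the Ogg–Saito schema and Prop. 10.8 (i) only, the
Frey–Hellegouarch root `vonKanelMatschke_lemma_10_5` being now the theorem `vonKanelMatschke_lemma_10_5_holds`:
Prop. 10.6 (`abc_log_max_le_refined`), (eq:asymptoticsu), vK 2014 Cor. 7.2, Murty–Pasten Thm. 1.1 and its `abc` form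
Thm. 1.2, and the asymptotic shapes. [cite: VonkanelMatschke2023, §10.4 (proofs of Lemma 10.5, Prop. 10.6, Prop. 10.2)] -/
theorem abc_family_of_modularity (hmod : nonempty_modularParametrizationData)
    (hOS : ∀ (W : WeierstrassCurve ℚ) (ℓ : ℕ) [Fact ℓ.Prime],
      W.artinConductorExponent_tate_eq_conductorExponent_of_isElliptic ℓ)
    (hi : vonKanelMatschke_prop_10_8_i) :
    abc_log_max_le_refined ∧ eq_asymptoticsu ∧ vonKanel2014_sUnit_height_le ∧
      MurtyPasten.sUnit_height_lt ∧ MurtyPasten.abc_log_max_lt ∧ MurtyPasten.sUnit_height_asymptotic ∧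
      MurtyPasten.abc_log_max_asymptotic :=
  have h105 := vonKanelMatschke_lemma_10_5_holds
  ⟨abc_log_max_le_refined_of_modularity_of_prop_10_8_i hmod hOS h105 hi,
    eq_asymptoticsu_of_roots hmod hOS h105 hi, vonKanel2014_sUnit_height_le_of_roots hmod hOS h105 hi,
    MurtyPasten.sUnit_height_lt_of_roots hmod hOS h105 hi, MurtyPasten.abc_log_max_lt_of_roots hmod hOS h105 hi,
    MurtyPasten.sUnit_height_asymptotic_of_roots hmod hOS h105 hi,
    MurtyPasten.abc_log_max_asymptotic_of_roots hmod hOS h105 hi⟩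

/-- **The `S`-unit / `abc` family from `{hmod, hOS, h103, hi}`** (`sUnit_family_of_roots` with the root `h105`
discharged by `vonKanelMatschke_lemma_10_5_holds`): Prop. 10.7 (both halves), Prop. 10.6, (eq:asymptoticsu), vK 2014
Cor. 7.2, Murty–Pasten Thm. 1.1 / 1.2 and the asymptotic shapes.
[cite: VonkanelMatschke2023, §10.4–§10.5 (proofs of Prop. 10.2, 10.6, 10.7)] -/
theorem sUnit_family_of_roots' (hmod : nonempty_modularParametrizationData)
    (hOS : ∀ (W : WeierstrassCurve ℚ) (ℓ : ℕ) [Fact ℓ.Prime],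
      W.artinConductorExponent_tate_eq_conductorExponent_of_isElliptic ℓ)
    (h103 : vonKanelMatschke_lemma_10_3) (hi : vonKanelMatschke_prop_10_8_i) :
    proposition_10_7 ∧ abc_log_max_le_refined ∧ eq_asymptoticsu ∧ vonKanel2014_sUnit_height_le ∧
      MurtyPasten.sUnit_height_lt ∧ MurtyPasten.abc_log_max_lt ∧ MurtyPasten.sUnit_height_asymptotic ∧
      MurtyPasten.abc_log_max_asymptotic :=
  sUnit_family_of_roots hmod hOS vonKanelMatschke_lemma_10_5_holds h103 hi

/-! ### Without the Ogg–Saito schema: conductor invariance from modularity (2026-08-27) -/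

/-- **The `abc` family from `{hmod, hi}` — modularity and Prop. 10.8 (i) only.** The conductor invariance
`N_{E'} = N_E` under isogeny used in the proofs of Prop. 10.6 / (eq:asymptoticsu) is
`conductorNorm_eq_of_isIsogenous_of_modularity hmod`, Lemma 10.5 is the theorem
`vonKanelMatschke_lemma_10_5_holds`, (eq:szpiro) and its asymptotic form come from Prop. 10.8 (i):
Prop. 10.6 (`abc_log_max_le_refined`), Prop. 10.2 (refined display for every `S`; both displays for `N_S ≥ 53`),
(eq:asymptoticsu), vK 2014 Cor. 7.2, Murty–Pasten Thm. 1.1, Thm. 1.2 and their asymptotic shapes.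
[cite: VonkanelMatschke2023, §10.4 (proofs of Lemma 10.5, Prop. 10.6, Prop. 10.2) and §10.5 (Prop. 10.8)] -/
theorem abc_family_of_modularity_of_prop_10_8_i (hmod : nonempty_modularParametrizationData)
    (hi : vonKanelMatschke_prop_10_8_i) :
    abc_log_max_le_refined ∧
      (∀ (S : Finset ℕ), (∀ p ∈ S, p.Prime) → ∀ x y : ℚ, IsSUnit S x → IsSUnit S y → x + y = 1 →
        max (Height.logHeight₁ x) (Height.logHeight₁ y) ≤
          12 / 5 * (primesProd S : ℝ) * Real.log (primesProd S) +
            9 / 10 * (primesProd S : ℝ) * Real.log (Real.log (Real.log (16 * (primesProd S : ℝ)))) +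
            8.26 * (primesProd S : ℝ) + 28) ∧
      (∀ (S : Finset ℕ), (∀ p ∈ S, p.Prime) → 53 ≤ primesProd S → ∀ x y : ℚ, IsSUnit S x → IsSUnit S y →
        x + y = 1 →
        max (Height.logHeight₁ x) (Height.logHeight₁ y) ≤
          5 / 2 * (primesProd S : ℝ) * Real.log (primesProd S) + 9 * (primesProd S : ℝ)) ∧
      eq_asymptoticsu ∧ vonKanel2014_sUnit_height_le ∧
      MurtyPasten.sUnit_height_lt ∧ MurtyPasten.abc_log_max_lt ∧ MurtyPasten.sUnit_height_asymptotic ∧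
      MurtyPasten.abc_log_max_asymptotic :=
  have hcond : ∀ (W W' : WeierstrassCurve ℚ) [W.IsElliptic] [W'.IsElliptic],
      W.IsIsogenous W' → W.conductorNorm ℤ = W'.conductorNorm ℤ :=
    fun W W' _ _ hiso ↦ conductorNorm_eq_of_isIsogenous_of_modularity hmod W W' hiso
  have h106 : abc_log_max_le_refined :=
    abc_log_max_le_refined_of_lemma_10_5_of_conductorNorm_eq hmod hcond vonKanelMatschke_lemma_10_5_holds
      (log_minimalDiscriminant_le_of_prop_10_8_i hmod hi)
  have hasu : eq_asymptoticsu :=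
    eq_asymptoticsu_of_lemma_10_5_of_conductorNorm_eq hcond vonKanelMatschke_lemma_10_5_holds
      (log_minimalDiscriminant_le_asymptotic_of_prop_10_8_i hmod hi)
  have hMP : MurtyPasten.sUnit_height_lt := MurtyPasten.sUnit_height_lt_of_abc_log_max_le_refined h106
  ⟨h106, sUnitEquation_height_le_two_of_abc_log_max_le_refined h106,
    fun S hS hN x y hx hy hxy ↦
      (abc_log_max_le_refined_imp_sUnitEquation_height_le_of_le h106 S hS hN x y hx hy hxy).1,
    hasu, vonKanel2014_sUnit_height_le_of_abc_log_max_le_refined h106, hMP,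
    MurtyPasten.abc_log_max_lt_of_sUnit_height_lt hMP,
    MurtyPasten.sUnit_height_asymptotic_of_abc_log_max_le_refined h106,
    MurtyPasten.abc_log_max_asymptotic_of_eq_asymptoticsu hasu⟩

/-- **The `S`-unit / `abc` family from `{hmod, h103, hi}`** (no Ogg–Saito schema, no Lemma 10.5 root):
Prop. 10.7 (both halves; its Mordell half needs Lemma 10.3), Prop. 10.6, (eq:asymptoticsu), vK 2014 Cor. 7.2,
Murty–Pasten Thm. 1.1 / 1.2 and the asymptotic shapes.
[cite: VonkanelMatschke2023, §10.4–§10.5 (proofs of Prop. 10.2, 10.6, 10.7)] -/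
theorem sUnit_family_of_modularity_of_lemma_10_3 (hmod : nonempty_modularParametrizationData)
    (h103 : vonKanelMatschke_lemma_10_3) (hi : vonKanelMatschke_prop_10_8_i) :
    proposition_10_7 ∧ abc_log_max_le_refined ∧ eq_asymptoticsu ∧ vonKanel2014_sUnit_height_le ∧
      MurtyPasten.sUnit_height_lt ∧ MurtyPasten.abc_log_max_lt ∧ MurtyPasten.sUnit_height_asymptotic ∧
      MurtyPasten.abc_log_max_asymptotic :=
  have h := abc_family_of_modularity_of_prop_10_8_i hmod hi
  ⟨proposition_10_7_of_conductorNorm_eq hmod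
      (fun W W' _ _ hiso ↦ conductorNorm_eq_of_isIsogenous_of_modularity hmod W W' hiso)
      vonKanelMatschke_lemma_10_5_holds h103 hi,
    h.1, h.2.2.2⟩

/-- **All three families from the three remaining roots `{hmod, hi, h103, h104}`** — modularity, Prop. 10.8 (i),
Lemma 10.3, Lemma 10.4 (the Ogg–Saito schema and Lemma 10.5 being no longer hypotheses): the Mordell family
(`mordell_family_of_roots`), the `S`-unit / `abc` family with Prop. 10.7, and the curve family.
[cite: VonkanelMatschke2023, §10 (structure of the proofs)] -/
theorem vonKanelMatschke_families_of_three_roots (hmod : nonempty_modularParametrizationData)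
    (hi : vonKanelMatschke_prop_10_8_i) (h103 : vonKanelMatschke_lemma_10_3)
    (h104 : vonKanelMatschke_lemma_10_4) :
    (mordell_height_le ∧ theorem_7_2_i ∧ theorem_7_2_ii ∧ theoremG ∧ corollaryH ∧ corollary_7_3 ∧
        corollary_7_4 ∧ corollary_9_1 ∧ corollary_9_1_sim ∧ corollary_9_3_sim ∧ corollary_L ∧
        vonKanel2014_mordell_height_le ∧ vonKanel2014_mordell_height_le_rpow) ∧
      (proposition_10_7 ∧ abc_log_max_le_refined ∧ eq_asymptoticsu ∧ vonKanel2014_sUnit_height_le ∧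
        MurtyPasten.sUnit_height_lt ∧ MurtyPasten.abc_log_max_lt ∧ MurtyPasten.sUnit_height_asymptotic ∧
        MurtyPasten.abc_log_max_asymptotic) ∧
      (vonKanel2014_height_le ∧ vonKanel2014_log_minimalDiscriminant_le ∧
        vonKanelMatschke_log_minimalDiscriminant_le ∧ vonKanelMatschke_log_minimalDiscriminant_le_asymptotic) :=
  ⟨mordell_family_of_roots hmod h103 h104 hi, sUnit_family_of_modularity_of_lemma_10_3 hmod h103 hi,
    curve_family_of_roots hmod hi⟩

end VonKanelMatschke

end Literature.NumberTheory.DiophantineGeometry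

end
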